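import Summits.Ventures.PercRepro.S1TriangleCount
import Summits.Ventures.PercRepro.RankLevelSetCorankFiveCounts

/-!
# PercRepro — LEMMA T′, PART A: THE STAR OF A POINT ON `d` TRIANGLES (p7, gen 3; sub-claim S2)

p2's LEMMA T (S1TriangleCount: `2·s₃ ≤ d(d + 1)` under (C1), by deletion induction with «at most `d` triangles through
a point») loses one triangle at every step: if a point `e` lies on EXACTLY `d` triangles, then their union `U`
(`2d + 1` points of rank `d + 1`) carries the whole nullity, so every circuit lies inside `U`
(`isCircuit_subset_of_nullity_full`: a circuit `T ⊄ U` would give `U ∪ T` nullity `d + 1` by submodularity), and no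
triangle inside `U` avoids `e` (`no_triangle_avoiding_of_card_eq`: a triangle containing a full pair `T_i ∖ {e}` would
put four points on a line, (C1); a triangle meeting three pairs would be independent, since those three triangles
through `e` span rank exactly `4` by submodularity against the remaining `d − 3`). Hence `s₃ = d` in that case, and
otherwise at most `d − 1` triangles pass through `e`: `s₃(d) ≤ (d − 1) + s₃(d − 1)`, so
**`s₃ ≤ 1 + d(d − 1)/2`** for `d ≥ 1` (`ncard_triangles_le_one_add`; `d(d+1)/2 − (d − 1)` — tight at `d = 3`, the
complete quadrilateral). Axioms: standard.
-/

open scoped Matroid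

namespace PercRepro

namespace S2

open Set

variable {α : Type}

/-- **Every circuit lies inside a set carrying the whole nullity**: if `|E| = r(E) + d` and `U ⊆ E` has
`|U| = r(U) + d`, then every circuit `T` satisfies `T ⊆ U` (else `U ∪ T` would have nullity `d + 1`). -/
theorem isCircuit_subset_of_nullity_full (M : Matroid α) [M.Finite] {d : ℕ} (hd : M.E.encard = M.eRank + d)
    {U : Set α} (hU : U ⊆ M.E) {r : ℕ} (hr : M.eRk U = r) (hUc : U.ncard = r + d)
    {T : Set α} (hT : M.IsCircuit T) : T ⊆ U := by
  by_contra hTU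
  have hTE : T ⊆ M.E := hT.subset_ground
  have hUfin : U.Finite := M.ground_finite.subset hU
  have hTfin : T.Finite := M.ground_finite.subset hTE
  -- `U ∩ T` is a proper subset of the circuit `T`, hence independent
  have hssub : U ∩ T ⊂ T := by
    refine ⟨inter_subset_right, fun h => hTU (fun z hz => (h hz).1)⟩
  have hindep : M.Indep (U ∩ T) := hT.ssubset_indep hssub
  have hrI : M.eRk (U ∩ T) = (U ∩ T).encard := hindep.eRk_eq_encard
  have hrT : M.eRk T + 1 = T.encard := hT.eRk_add_one_eq
  have hsub := M.eRk_inter_add_eRk_union_le U T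
  have hcap := Matroid.encard_le_eRk_add_of_encard_eq (M := M) (union_subset hU hTE) hd
  have hcard := Set.encard_union_add_encard_inter U T
  -- pass to `ℕ`
  have hne1 : M.eRk (U ∪ T) ≠ ⊤ := ((M.eRk_le_encard _).trans_lt (hUfin.union hTfin).encard_lt_top).ne
  have hne2 : M.eRk T ≠ ⊤ := ((M.eRk_le_encard _).trans_lt hTfin.encard_lt_top).ne
  obtain ⟨a, ha⟩ := ENat.ne_top_iff_exists.1 hne1
  obtain ⟨b, hb⟩ := ENat.ne_top_iff_exists.1 hne2
  rw [← ha, hr, ← hb, hrI, ← (hUfin.inter_of_left T).cast_ncard_eq] at hsub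
  rw [← ha, ← (hUfin.union hTfin).cast_ncard_eq] at hcap
  rw [← hb, ← hTfin.cast_ncard_eq] at hrT
  rw [← (hUfin.union hTfin).cast_ncard_eq, ← (hUfin.inter_of_left T).cast_ncard_eq,
    ← hUfin.cast_ncard_eq, ← hTfin.cast_ncard_eq] at hcard
  have e1 : (U ∩ T).ncard + a ≤ r + b := by exact_mod_cast hsub
  have e2 : (U ∪ T).ncard ≤ a + d := by exact_mod_cast hcap
  have e3 : b + 1 = T.ncard := by exact_mod_cast hrT
  have e4 : (U ∪ T).ncard + (U ∩ T).ncard = U.ncard + T.ncard := by exact_mod_cast hcard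
  omega

/-- The triangles through `e`, as a finset. -/
noncomputable def trianglesThroughF (M : Matroid α) [M.Finite] (e : α) : Finset (Set α) :=
  (M.ground_finite.finite_subsets.subset (fun C (hC : C ∈ ThmN.trianglesThrough M e) => hC.1.subset_ground)).toFinset

/-- Membership in `trianglesThroughF`. -/
theorem mem_trianglesThroughF (M : Matroid α) [M.Finite] {e : α} {C : Set α} :
    C ∈ trianglesThroughF M e ↔ C ∈ ThmN.trianglesThrough M e := Set.Finite.mem_toFinset _

/-- `#trianglesThroughF M e = #(trianglesThrough M e)`. -/
theorem card_trianglesThroughF (M : Matroid α) [M.Finite] (e : α) :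
    (trianglesThroughF M e).card = (ThmN.trianglesThrough M e).ncard := by
  unfold trianglesThroughF
  rw [← Set.ncard_eq_toFinset_card _ _]

/-- **The star of `e` carries the whole nullity when `e` lies on `d` triangles**: then `U = {e} ∪ ⋃ T_i` has
`|U| = 2d + 1` and `r(U) = d + 1`. -/
theorem eRk_star_eq_of_card_eq (M : Matroid α) [M.Finite]
    (hC1 : ∀ L ⊆ M.E, M.eRk L = 2 → L.ncard ≤ 3) {e : α} (hx : M.IsNonloop e) {d : ℕ}
    (hd : M.E.encard = M.eRank + d) (hcard : (trianglesThroughF M e).card = d) :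
    M.eRk ({e} ∪ ⋃ C ∈ trianglesThroughF M e, C) = ((d + 1 : ℕ) : ℕ∞) ∧
      ({e} ∪ ⋃ C ∈ trianglesThroughF M e, C).ncard = 2 * d + 1 := by
  classical
  set s := trianglesThroughF M e with hsdef
  have hs : ∀ C ∈ s, C ∈ ThmN.trianglesThrough M e := fun C hC => (mem_trianglesThroughF M).1 hC
  obtain ⟨hr, hc⟩ := ThmN.eRk_le_and_ncard_eq_of_triangles M hC1 hx s hs
  rw [hcard] at hr hc
  set U : Set α := {e} ∪ ⋃ C ∈ s, C with hU
  have hUE : U ⊆ M.E := by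
    intro z hz
    rcases hz with hz | hz
    · rw [Set.mem_singleton_iff.1 hz]; exact hx.mem_ground
    · obtain ⟨C, hC, hzC⟩ := Set.mem_iUnion₂.1 hz
      exact (hs C hC).1.subset_ground hzC
  have hUfin : U.Finite := M.ground_finite.subset hUE
  have hcap := Matroid.encard_le_eRk_add_of_encard_eq (M := M) hUE hd
  have hne : M.eRk U ≠ ⊤ := ((M.eRk_le_encard _).trans_lt hUfin.encard_lt_top).ne
  obtain ⟨a, ha⟩ := ENat.ne_top_iff_exists.1 hne
  rw [← ha] at hr hcap
  rw [← hUfin.cast_ncard_eq, hc] at hcap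
  have e1 : a ≤ 1 + d := by exact_mod_cast hr
  have e2 : 1 + 2 * d ≤ a + d := by exact_mod_cast hcap
  have e3 : a = d + 1 := by omega
  refine ⟨?_, by rw [hc]; ring⟩
  rw [← ha, e3]

/-- **A triangle through `e` cannot contain two points of a triangle avoiding `e`** (under (C1)): the line through
those two points would carry `e`, both points and the third point of the avoiding triangle — four points. -/
theorem no_pair_of_trianglesThrough (M : Matroid α) [M.Finite]
    (hC1 : ∀ L ⊆ M.E, M.eRk L = 2 → L.ncard ≤ 3) {e : α} (hx : M.IsNonloop e)
    {T : Set α} (hT : M.IsCircuit T) (hT3 : T.ncard = 3) (heT : e ∉ T)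
    {C : Set α} {a b : α} (hC' : C ∈ ThmN.trianglesThrough M e) (haC : a ∈ C) (hbC : b ∈ C)
    (haT : a ∈ T) (hbT : b ∈ T) (hab : a ≠ b) : False := by
  have hTE : T ⊆ M.E := hT.subset_ground
  have hTfin : T.Finite := M.ground_finite.subset hTE
  obtain ⟨x, y, z, hxy, hxz, hyz, hTxyz⟩ := Set.ncard_eq_three.1 hT3
  have hCE : C ⊆ M.E := hC'.1.subset_ground
  have hCfin : C.Finite := M.ground_finite.subset hCE
  have hea : e ≠ a := fun h => heT (h ▸ haT)
  have heb : e ≠ b := fun h => heT (h ▸ hbT)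
  -- `C = {e, a, b}`
  have hCeq : C = {e, a, b} := by
    symm
    apply Set.eq_of_subset_of_ncard_le
    · intro w hw
      simp only [Set.mem_insert_iff, Set.mem_singleton_iff] at hw
      rcases hw with rfl | rfl | rfl
      · exact hC'.2.2
      · exact haC
      · exact hbC
    · rw [hC'.2.1, Set.ncard_insert_of_notMem (by simp [hea, heb]) (by simp),
        Set.ncard_pair hab]
    · exact hCfin
  -- `e ∈ cl {a, b}`
  have he_cl : e ∈ M.closure {a, b} := by
    have := hC'.1.mem_closure_sdiff_singleton_of_mem hC'.2.2
    rw [hCeq] at this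
    have hdiff : ({e, a, b} : Set α) \ {e} = {a, b} := by
      ext w
      simp only [Set.mem_sdiff, Set.mem_insert_iff, Set.mem_singleton_iff]
      constructor
      · rintro ⟨h | h | h, hne⟩
        · exact absurd h hne
        · exact Or.inl h
        · exact Or.inr h
      · rintro (rfl | rfl)
        · exact ⟨Or.inr (Or.inl rfl), hea.symm⟩
        · exact ⟨Or.inr (Or.inr rfl), heb.symm⟩
    rwa [hdiff] at this
  -- the third point `c` of `T`: `c ∈ cl {a, b}`
  obtain ⟨c, hcT, hca, hcb⟩ : ∃ c ∈ T, c ≠ a ∧ c ≠ b := by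
    rw [hTxyz] at haT hbT ⊢
    simp only [Set.mem_insert_iff, Set.mem_singleton_iff] at haT hbT
    rcases haT with rfl | rfl | rfl <;> rcases hbT with rfl | rfl | rfl
    · exact absurd rfl hab
    · exact ⟨z, by simp, hxz.symm, hyz.symm⟩
    · exact ⟨y, by simp, hxy.symm, hyz⟩
    · exact ⟨z, by simp, hyz.symm, hxz.symm⟩
    · exact absurd rfl hab
    · exact ⟨x, by simp, hxy, hxz⟩
    · exact ⟨y, by simp, hyz, hxy.symm⟩
    · exact ⟨x, by simp, hxz, hxy⟩
    · exact absurd rfl hab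
  have hTeq : T = {a, b, c} := by
    symm
    apply Set.eq_of_subset_of_ncard_le
    · intro w hw
      simp only [Set.mem_insert_iff, Set.mem_singleton_iff] at hw
      rcases hw with rfl | rfl | rfl
      · exact haT
      · exact hbT
      · exact hcT
    · rw [hT3, Set.ncard_insert_of_notMem (by simp [hab, hca.symm]) (by simp),
        Set.ncard_pair hcb.symm]
    · exact hTfin
  have hc_cl : c ∈ M.closure {a, b} := by
    have := hT.mem_closure_sdiff_singleton_of_mem hcT
    rw [hTeq] at this
    have hdiff : ({a, b, c} : Set α) \ {c} = {a, b} := by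
      ext w
      simp only [Set.mem_sdiff, Set.mem_insert_iff, Set.mem_singleton_iff]
      constructor
      · rintro ⟨h | h | h, hne⟩
        · exact Or.inl h
        · exact Or.inr h
        · exact absurd h hne
      · rintro (rfl | rfl)
        · exact ⟨Or.inl rfl, hca.symm⟩
        · exact ⟨Or.inr (Or.inl rfl), hcb.symm⟩
    rwa [hdiff] at this
  -- the line `cl {a, b}` contains the four points `e, a, b, c`
  have hab_sub : ({a, b} : Set α) ⊆ M.E := by
    intro w hw
    simp only [Set.mem_insert_iff, Set.mem_singleton_iff] at hw
    rcases hw with rfl | rfl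
    · exact hTE haT
    · exact hTE hbT
  have hL : ({e, a, b, c} : Set α) ⊆ M.closure {a, b} := by
    intro w hw
    simp only [Set.mem_insert_iff, Set.mem_singleton_iff] at hw
    rcases hw with rfl | rfl | rfl | rfl
    · exact he_cl
    · exact M.subset_closure _ hab_sub (by simp)
    · exact M.subset_closure _ hab_sub (by simp)
    · exact hc_cl
  have hab_indep : M.Indep {a, b} := by
    refine hT.ssubset_indep ⟨?_, ?_⟩
    · intro w hw
      simp only [Set.mem_insert_iff, Set.mem_singleton_iff] at hw
      rcases hw with rfl | rfl
      · exact haT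
      · exact hbT
    · intro h
      exact hca (Set.mem_insert_iff.1 (h hcT) |>.elim id (fun h' => absurd (Set.mem_singleton_iff.1 h') hcb))
  have hr2 : M.eRk ({e, a, b, c} : Set α) = 2 := by
    apply le_antisymm
    · calc M.eRk ({e, a, b, c} : Set α) ≤ M.eRk (M.closure {a, b}) := M.eRk_mono hL
        _ = M.eRk {a, b} := M.eRk_closure_eq _
        _ = ({a, b} : Set α).encard := hab_indep.eRk_eq_encard
        _ = 2 := Set.encard_pair hab
    · calc (2 : ℕ∞) = ({a, b} : Set α).encard := (Set.encard_pair hab).symm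
        _ = M.eRk {a, b} := hab_indep.eRk_eq_encard.symm
        _ ≤ M.eRk ({e, a, b, c} : Set α) := M.eRk_mono (by
            intro w hw
            simp only [Set.mem_insert_iff, Set.mem_singleton_iff] at hw ⊢
            rcases hw with rfl | rfl <;> simp)
  have hLE : ({e, a, b, c} : Set α) ⊆ M.E := by
    intro w hw
    simp only [Set.mem_insert_iff, Set.mem_singleton_iff] at hw
    rcases hw with rfl | rfl | rfl | rfl
    · exact hx.mem_ground
    · exact hTE haT
    · exact hTE hbT
    · exact hTE hcT
  have h4 := hC1 _ hLE hr2
  have hec : e ≠ c := fun h => heT (h ▸ hcT)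
  rw [Set.ncard_insert_of_notMem (by simp [hea, heb, hec]) (by simp),
    Set.ncard_insert_of_notMem (by simp [hab, hca.symm]) (by simp), Set.ncard_pair hcb.symm] at h4
  omega

/-- **A triangle through `e` and a point `a` of `T` lies in `cl (insert e T)`**: its third point is in `cl {e, a}`. -/
theorem trianglesThrough_subset_closure_insert (M : Matroid α) [M.Finite] {e : α} (hx : M.IsNonloop e)
    {T : Set α} (hT : M.IsCircuit T) (heT : e ∉ T) {C : Set α} {a : α}
    (hC' : C ∈ ThmN.trianglesThrough M e) (haC : a ∈ C) (haT : a ∈ T) : C ⊆ M.closure (insert e T) := by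
  have hTE : T ⊆ M.E := hT.subset_ground
  have hins : insert e T ⊆ M.E := Set.insert_subset hx.mem_ground hTE
  intro w hw
  have hCE : C ⊆ M.E := hC'.1.subset_ground
  have hCfin : C.Finite := M.ground_finite.subset hCE
  have hea : e ≠ a := fun h => heT (h ▸ haT)
  by_cases hwe : w = e
  · exact M.subset_closure _ hins (by rw [hwe]; exact Set.mem_insert e T)
  by_cases hwa : w = a
  · exact M.subset_closure _ hins (by rw [hwa]; exact Set.mem_insert_of_mem e haT)
  -- `C = {e, a, w}`, so `w ∈ cl (C ∖ {w}) = cl {e, a} ⊆ cl (insert e T)`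
  have hCeq : C = {e, a, w} := by
    symm
    apply Set.eq_of_subset_of_ncard_le
    · intro v hv
      simp only [Set.mem_insert_iff, Set.mem_singleton_iff] at hv
      rcases hv with rfl | rfl | rfl
      · exact hC'.2.2
      · exact haC
      · exact hw
    · rw [hC'.2.1, Set.ncard_insert_of_notMem (by simp [hea, Ne.symm hwe]) (by simp),
        Set.ncard_pair (Ne.symm hwa)]
    · exact hCfin
  have := hC'.1.mem_closure_sdiff_singleton_of_mem hw
  rw [hCeq] at this
  have hdiff : ({e, a, w} : Set α) \ {w} = {e, a} := by
    ext v
    simp only [Set.mem_sdiff, Set.mem_insert_iff, Set.mem_singleton_iff]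
    constructor
    · rintro ⟨h | h | h, hne⟩
      · exact Or.inl h
      · exact Or.inr h
      · exact absurd h hne
    · rintro (rfl | rfl)
      · exact ⟨Or.inl rfl, Ne.symm hwe⟩
      · exact ⟨Or.inr (Or.inl rfl), Ne.symm hwa⟩
  rw [hdiff] at this
  refine M.closure_subset_closure ?_ this
  intro v hv
  simp only [Set.mem_insert_iff, Set.mem_singleton_iff] at hv
  rcases hv with rfl | rfl
  · exact Set.mem_insert v T
  · exact Set.mem_insert_of_mem e haT

end S2

end PercRepro
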